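import Summits.ResolutionOfSingularities.ResolutionOfSingularities.Theorems.FrobeniusLadderFRationalResolutionDiagQuotientSurface
import Summits.ResolutionOfSingularities.ResolutionOfSingularities.Theorems.FrobeniusLadderFRationalResolutionToricSurfaceStalks
import HarnessLib

/-!
# Crux `FrobeniusLadder.FRationalResolution` (stmt-ResolutionOfSingularities-15317), line `redirect`,
# stub `stub_diagonalizableQuotientResolution` — the SURFACE case with Zariski-toric singular germs

`…DiagQuotientSurface.lean`: under the stub's hypothesis `hq` verbatim and `dim X ≤ 2`, the singular
locus is a finite set of closed points. `…ToricSurfaceStalks.lean`: finitely many singular points with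
toric surface vertex germs `U(r,a)` ⇒ resolution, over any field. Together:

* `stub_diagonalizableQuotientResolution_of_surface_of_toric_stalks` — **the stub in dimension `≤ 2`
  (binders verbatim, plus `dim X ≤ 2`) for `X` whose singular local rings are `k`-isomorphic to vertex
  local rings of affine toric surfaces `U(r,a)`** — i.e. the dim-`2` slice modulo exactly the
  recognition step «an étale chart from `Spec S₀` (`S` regular, `A`-graded) at a singular surface point
  makes `𝒪_{X,x}` a Zariski `U(r,a)`-germ» (open in the tree: L2 of the census).

No definitions, no named facts, no sorry. [folklore; cite: Kollar2007, §2.2; CoxLittleSchenck2011, Thm. 10.1.10]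
-/

-- single-problem summit: the doubled namespace component is forced
set_option linter.dupNamespace false

noncomputable section

namespace Summit.ResolutionOfSingularities.ResolutionOfSingularities.Theorems.FRationalResolution

open CategoryTheory AlgebraicGeometry TopologicalSpace
open Literature.AlgebraicGeometry.Resolution

section Toric

variable (k : Type) [Field k]

/-- The Laurent polynomial ring `k[ℤ²]` (coordinate ring of the 2-torus). -/
local notation3 "Lk" => AddMonoidAlgebra k (ℤ × ℤ)

/-- The lattice points of the dual cone `σ∨ = {m₂ ≥ 0, a m₂ ≤ r m₁}` of `σ = cone((0,1),(r,-a))`. -/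
local notation3 "σS[" r ", " a "]" =>
  {m : ℤ × ℤ | 0 ≤ m.2 ∧ ((a : ℕ) : ℤ) * m.2 ≤ ((r : ℕ) : ℤ) * m.1}

/-- The toric surface algebra `k[σ∨ ∩ ℤ²] ⊆ k[ℤ²]`. -/
local notation3 "TA[" r ", " a "]" =>
  Algebra.adjoin k ((fun m : ℤ × ℤ => AddMonoidAlgebra.single m (1 : k)) '' σS[r, a])

namespace DiagQuotientSurfaceToric

/-- **`stub_diagonalizableQuotientResolution` IN DIMENSION `≤ 2` FOR ZARISKI-TORIC SINGULAR GERMS**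
(the stub's binders verbatim, plus `dim X ≤ 2` and, at each singular point, a `k`-isomorphism of its
local ring with the vertex local ring of some `U(r,a)`, `a < r`): `X` has a resolution of
singularities. The singular locus is finite by `DiagQuotientSurface.diagQuotient_surface_singularLocus`
(normality under `hq`), and `ToricSurfaceStalks.hasResolution_of_toricSurface_stalks` glues the
Hirzebruch–Jung local resolutions. [folklore; cite: Kollar2007, §2.2] -/
theorem stub_diagonalizableQuotientResolution_of_surface_of_toric_stalks (X : Scheme.{0})
    (g : X ⟶ Spec (.of k)) [IsIntegral X] [IsSeparated g] [LocallyOfFiniteType g] [QuasiCompact g]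
    (hq : ∀ x : X, ∃ (A : Type) (_ : AddCommGroup A) (_ : Finite A) (_ : DecidableEq A)
        (S : Type) (_ : CommRing S) (_ : Algebra k S) (𝒮 : A → Submodule k S)
        (_ : GradedAlgebra 𝒮), Algebra.FiniteType k S ∧ IsRegularRing S ∧
        ∃ φ : Spec (.of (𝒮 0)) ⟶ X, Etale φ ∧ x ∈ Set.range φ ∧
          φ ≫ g = Spec.map (CommRingCat.ofHom (algebraMap k (𝒮 0))))
    (hdim : topologicalKrullDim X ≤ 2)
    (hstalk : ∀ s : X, s ∉ Scheme.regularLocus X → ∃ (r a : ℕ) (_ : a < r) (x w : ↥TA[r, a])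
      (_ : (x : Lk) = AddMonoidAlgebra.single ((1 : ℤ), (0 : ℤ)) 1)
      (_ : (w : Lk) = AddMonoidAlgebra.single ((a : ℤ), (r : ℤ)) 1)
      (q : Spec (CommRingCat.of ↥TA[r, a])) (_ : x ∈ q.asIdeal ∧ w ∈ q.asIdeal)
      (e : (Spec (CommRingCat.of ↥TA[r, a])).presheaf.stalk q ≅ X.presheaf.stalk s),
      Spec.map e.hom ≫ (Spec (CommRingCat.of ↥TA[r, a])).fromSpecStalk q ≫
        Spec.map (CommRingCat.ofHom (algebraMap k ↥TA[r, a])) = X.fromSpecStalk s ≫ g) :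
    Scheme.HasResolution X :=
  ToricSurfaceStalks.hasResolution_of_toricSurface_stalks k X g
    (DiagQuotientSurface.diagQuotient_surface_singularLocus k X g hq hdim).1 hstalk

end DiagQuotientSurfaceToric

end Toric

end Summit.ResolutionOfSingularities.ResolutionOfSingularities.Theorems.FRationalResolution

end
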